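import Summits.QuantumAdvantage.QuantumAdvantage.Theorems.CubicForrelationSignedExactCubicForrelationNotPrBPPFinderMachine

/-!
# Crux `CubicForrelation.SignedExactCubicForrelationNotPrBPP` (stmt-QuantumAdvantage-13932), line `dual-pingpong-frame`
# (GROW reshape): the GROW machine, I — offset-closure bricks over `𝔽₂` and their `CodeFP`

Support file (`--supports stmt-QuantumAdvantage-13932`) toward the registered stub `stub_growFinder` (the randomised
GROW finder of a half-dimensional M-subspace of the second function `g = C₁` of an exact cubic pair). The machine
(`…GrowMachine.lean`) grows a CLOSED ORTHOGONAL PAIR `(S, U)` of row bases by candidates drawn from probe kernels;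
this file supplies the one-function bricks it is written in (vectors and matrices are bit lists, as in
`…FinderMachineBricks.lean`, whose `normV`, `basisOf`, `kerOf`, `inSpan` are reused), each with its typed
polynomial-time certificate (`CodeFP`, Arora–Barak 2009, §1.3):

* `rowOf n c s y` — the slice row `k ↦ D_s D_y c (0) ⊕ D_s D_y c (e_k)` (eight circuit evaluations per entry,
  `MMReadout.d2`); `sliceOf n c s` — the slice `B_s` (rows `rowOf n c s eᵢ`, `i < n`; its kernel is the radical
  `rad B_s`); `stackOf n c S` — the stacked slices of a row list (kernel `⋂ᵢ rad B_{sᵢ}`);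
* `betaOf n c s r = c r ⊕ c (r ⊕ s) ⊕ c 0 ⊕ c s` — the OFFSET functional `β_s(r) = D_s D_r c (0)`, linear on
  `rad B_s` for a cubic `c`; `dualOf n c s R` — its dual vector read off a swept state `R` (value on the pivot row at
  each pivot column, `0` at the free columns: the solution vector of `ℓ · r = β_s(r)` on the row span, cf.
  `MMReadout.x0Of`, `F2Elim.dotZ_dualVec_eq`); `offsOf n c S A` — the offsets `ℓ_{sᵢ}` of the rows of `S` solved on
  the kernel of `A`;
* `lamOf n c S = stackOf n c S ++ offsOf n c S (stackOf n c S)` — generators of `Λ_c(S)`, the space that closedness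
  requires inside the partner; `closedChk n c S U` — every generator lies in `span U` (rank test `inSpan`);
  `orthChk n S U` — all pairwise inner products vanish (`MMReadout.dotL`).

No statement here depends on the hidden structure of the instance; the algebraic meaning of the bricks is used only
by the completeness analysis (`…GrowMachineSound.lean` ff.).

## References

* S. Arora, B. Barak, *Computational Complexity: A Modern Approach*, CUP 2009, §1.3 (polynomial time: composition
  and polynomially bounded loops). [AroraBarak2009]
* D. E. Knuth, *TAOCP* Vol. 2, 3rd ed., §4.6.2 Algorithm N (null space / rank by column reduction). [KnuthTAOCP2]
* C. Carlet, *Boolean Functions for Cryptography and Coding Theory*, CUP 2021, §2.2.2 (derivatives), Prop. 54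
  (M-subspaces of the Maiorana–McFarland class). [Carlet2020]
-/

noncomputable section

set_option linter.dupNamespace false -- D-0017: single-problem summit ⇒ `QuantumAdvantage.QuantumAdvantage` by design

namespace Summit.QuantumAdvantage.QuantumAdvantage.Theorems.SignedExactCubicForrelationNotPrBPP.GrowMachine

open _root_.Computability Literature.Computability.Complexity Literature.Computability.Complexity.CodeFP
open Literature.Computability.QuantumComplexity
open Literature.Computability.Complexity.F2Elim (bxorL Row rrun isPiv prow kvec bitsE stCE)
open ForrCode QuadSampler CubicDequant MMReadout
open FinderMachine (Vec Mat matE normV basisOf kerOf inSpan shaped_basisOf basisOf_codeFP kerOf_codeFP inSpan_codeFP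
  normV_codeFP shapeP shapeP_eval length_matE_le length_matE_le_shapeP foldlInv)

/-! ### Slice rows, slices, offsets -/

/-- **The slice row** `row_c(s, y) = (k ↦ D_s D_y c (0) ⊕ D_s D_y c (e_k))` — for a cubic `c` the third derivative
`k ↦ T_c(s, y, e_k)`; verbatim the row of the line's closedness clause. [cite: Carlet2020, §2.2.2] -/
def rowOf (n : ℕ) (c : PCirc) (s y : Vec) : Vec :=
  (List.range n).map fun k => (d2 c (zeroL n) s y ^^ d2 c (unitL n k) s y)

/-- **The slice** `B_s`: the rows `row_c(s, eᵢ)`, `i < n` (kernel = the radical `rad B_s`). [cite: Carlet2020, §2.2.2] -/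
def sliceOf (n : ℕ) (c : PCirc) (s : Vec) : Mat := (List.range n).map fun i => rowOf n c s (unitL n i)

/-- The stacked slices of the rows of `S` (kernel `⋂ᵢ rad B_{sᵢ}`). [cite: Carlet2020, §2.2.2] -/
def stackOf (n : ℕ) (c : PCirc) (S : Mat) : Mat := (S.map (sliceOf n c)).flatten

/-- **The offset functional** `β_s(r) = c r ⊕ c (r ⊕ s) ⊕ c 0 ⊕ c s = D_s D_r c (0)`. [cite: Carlet2020, §2.2.2] -/
def betaOf (n : ℕ) (c : PCirc) (s r : Vec) : Bool := (evalP c r ^^ evalP c (bxorL r s) ^^ evalP c (zeroL n) ^^ evalP c s)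

/-- **The dual vector of `β_s`** with respect to a swept state `R`: `β_s(pivot row of j)` at a pivot column `j`,
`0` at a free column (cf. `MMReadout.x0Of`). [cite: KnuthTAOCP2, §4.6.2 Algorithm N] -/
def dualOf (n : ℕ) (c : PCirc) (s : Vec) (R : List Row) : Vec := (List.range n).map fun j => isPiv R j && betaOf n c s (prow R j)

/-- **The offsets** `ℓ_{sᵢ}` of the rows of `S`, each solved on the kernel of `A` (dual vector of `β_{sᵢ}` with
respect to the reduced kernel basis of `A`). [cite: KnuthTAOCP2, §4.6.2 Algorithm N] -/
def offsOf (n : ℕ) (c : PCirc) (S A : Mat) : Mat := S.map fun s => dualOf n c s (rrun n (kerOf n A))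

/-- **Generators of `Λ_c(S)`**: the stacked slice rows of `S` and the offsets of `S` solved on their common kernel.
[cite: Carlet2020, Prop. 54] -/
def lamOf (n : ℕ) (c : PCirc) (S : Mat) : Mat := stackOf n c S ++ offsOf n c S (stackOf n c S)

/-- **Closedness check** of `(S, U)` for `c`: every generator of `Λ_c(S)` lies in `span U`. [cite: Carlet2020, Prop. 54] -/
def closedChk (n : ℕ) (c : PCirc) (S U : Mat) : Bool := (lamOf n c S).all fun x => inSpan n U x

/-- **Orthogonality check**: all inner products between rows of `S` and rows of `U` vanish. [folklore] -/
def orthChk (n : ℕ) (S U : Mat) : Bool := (S.product U).all fun p => !dotL n p.1 p.2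

/-! ### Shapes -/

/-- `|rowOf| = n`. [folklore] -/
@[simp] theorem length_rowOf (n : ℕ) (c : PCirc) (s y : Vec) : (rowOf n c s y).length = n := by simp [rowOf]

/-- `|dualOf| = n`. [folklore] -/
@[simp] theorem length_dualOf (n : ℕ) (c : PCirc) (s : Vec) (R : List Row) : (dualOf n c s R).length = n := by simp [dualOf]

/-! ### `CodeFP` of the bricks -/

/-- The code of the row context `(n, (c, (s, y)))`. [folklore] -/
abbrev RWE : ℕ × (PCirc × (Vec × Vec)) → List Bool := pairE unE (pairE pcE (pairE bitsE bitsE))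

/-- Slice rows on codes: `(n, (c, (s, y))) ↦ rowOf n c s y`. [cite: AroraBarak2009, §1.3] -/
theorem rowOf_codeFP : CodeFP RWE bitsE (fun t => rowOf t.1 t.2.1 t.2.2.1 t.2.2.2) := by
  -- item `k`, context `t : RWE`
  have hn : CodeFP (pairE RWE natE) unE (fun q => q.1.1) := (fst _ _).fst'
  have hc : CodeFP (pairE RWE natE) pcE (fun q => q.1.2.1) := (fst _ _).snd'.fst'
  have hs : CodeFP (pairE RWE natE) bitsE (fun q => q.1.2.2.1) := (fst _ _).snd'.snd'.fst'
  have hy : CodeFP (pairE RWE natE) bitsE (fun q => q.1.2.2.2) := (fst _ _).snd'.snd'.snd'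
  have hk : CodeFP (pairE RWE natE) natE (fun q => q.2) := snd _ _
  have h1 := d2_codeFP.comp (hc.pair ((zeroL_codeFP.comp hn).pair (hs.pair hy)))
  have h2 := d2_codeFP.comp (hc.pair ((unitL_codeFP.comp (hn.pair hk)).pair (hs.pair hy)))
  have hm := CodeFP.map (σ := ℕ × (PCirc × (Vec × Vec))) (eσ := RWE) (eα := natE) (eβ := bitE)
    (g := fun q => (d2 q.1.2.1 (zeroL q.1.1) q.1.2.2.1 q.1.2.2.2 ^^ d2 q.1.2.1 (unitL q.1.1 q.2) q.1.2.2.1 q.1.2.2.2)) (h1.xor h2)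
  exact (hm.comp ((CodeFP.id _).pair (urange.comp (fst _ _)))).congr fun _ => rfl

/-- The code of the slice context `(n, (c, s))`. [folklore] -/
abbrev SLE : ℕ × (PCirc × Vec) → List Bool := pairE unE (pairE pcE bitsE)

/-- Slices on codes: `(n, (c, s)) ↦ sliceOf n c s`. [cite: AroraBarak2009, §1.3] -/
theorem sliceOf_codeFP : CodeFP SLE matE (fun t => sliceOf t.1 t.2.1 t.2.2) := by
  have hn : CodeFP (pairE SLE natE) unE (fun q => q.1.1) := (fst _ _).fst'
  have hc : CodeFP (pairE SLE natE) pcE (fun q => q.1.2.1) := (fst _ _).snd'.fst'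
  have hs : CodeFP (pairE SLE natE) bitsE (fun q => q.1.2.2) := (fst _ _).snd'.snd'
  have hi : CodeFP (pairE SLE natE) natE (fun q => q.2) := snd _ _
  have hg := rowOf_codeFP.comp (hn.pair (hc.pair (hs.pair (unitL_codeFP.comp (hn.pair hi)))))
  have hm := CodeFP.map (σ := ℕ × (PCirc × Vec)) (eσ := SLE) (eα := natE) (eβ := bitsE)
    (g := fun q => rowOf q.1.1 q.1.2.1 q.1.2.2 (unitL q.1.1 q.2)) hg
  exact (hm.comp ((CodeFP.id _).pair (urange.comp (fst _ _)))).congr fun _ => rfl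

/-- The code of the matrix context `(n, (c, S))`. [folklore] -/
abbrev STE : ℕ × (PCirc × Mat) → List Bool := pairE unE (pairE pcE matE)

/-- Stacked slices on codes: `(n, (c, S)) ↦ stackOf n c S`. [cite: AroraBarak2009, §1.3] -/
theorem stackOf_codeFP : CodeFP STE matE (fun t => stackOf t.1 t.2.1 t.2.2) := by
  have hg := sliceOf_codeFP.comp ((fst (pairE unE pcE) bitsE).fst'.pair ((fst (pairE unE pcE) bitsE).snd'.pair (snd _ _)))
  have hm := CodeFP.map (σ := ℕ × PCirc) (eσ := pairE unE pcE) (eα := bitsE) (eβ := matE)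
    (g := fun q => sliceOf q.1.1 q.1.2 q.2) hg
  have hctx : CodeFP STE (pairE unE pcE) (fun t => (t.1, t.2.1)) := (fst _ _).pair (snd _ _).fst'
  have h := (CodeFP.flatten bitsE).comp (hm.comp (hctx.pair (snd _ _).snd'))
  exact h.congr fun _ => rfl

/-- The offset functional on codes: `(n, (c, (s, r))) ↦ betaOf n c s r`. [cite: AroraBarak2009, §1.3] -/
theorem betaOf_codeFP : CodeFP RWE bitE (fun t => betaOf t.1 t.2.1 t.2.2.1 t.2.2.2) := by
  have hn : CodeFP RWE unE (fun t => t.1) := fst _ _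
  have hc : CodeFP RWE pcE (fun t => t.2.1) := (snd _ _).fst'
  have hs : CodeFP RWE bitsE (fun t => t.2.2.1) := (snd _ _).snd'.fst'
  have hr : CodeFP RWE bitsE (fun t => t.2.2.2) := (snd _ _).snd'.snd'
  have hev : ∀ {v : ℕ × (PCirc × (Vec × Vec)) → List Bool}, CodeFP RWE bitsE v → CodeFP RWE bitE (fun t => evalP t.2.1 (v t)) :=
    fun hv => evalP_codeFP.comp (hc.pair (bitsToStr.comp hv))
  have h1 := hev hr
  have h2 := hev (F2Elim.bxorL_codeFP.comp (hr.pair hs))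
  have h3 := hev (zeroL_codeFP.comp hn)
  have h4 := hev hs
  exact (((h1.xor h2).xor h3).xor h4).congr fun _ => rfl

/-- The code of the dual-vector context `(n, (c, (s, R)))`. [folklore] -/
abbrev DUE : ℕ × (PCirc × (Vec × List Row)) → List Bool := pairE unE (pairE pcE (pairE bitsE stCE))

/-- Dual vectors on codes: `(n, (c, (s, R))) ↦ dualOf n c s R`. [cite: AroraBarak2009, §1.3] -/
theorem dualOf_codeFP : CodeFP DUE bitsE (fun t => dualOf t.1 t.2.1 t.2.2.1 t.2.2.2) := by
  have hn : CodeFP (pairE DUE natE) unE (fun q => q.1.1) := (fst _ _).fst'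
  have hc : CodeFP (pairE DUE natE) pcE (fun q => q.1.2.1) := (fst _ _).snd'.fst'
  have hs : CodeFP (pairE DUE natE) bitsE (fun q => q.1.2.2.1) := (fst _ _).snd'.snd'.fst'
  have hR : CodeFP (pairE DUE natE) stCE (fun q => q.1.2.2.2) := (fst _ _).snd'.snd'.snd'
  have hj : CodeFP (pairE DUE natE) natE (fun q => q.2) := snd _ _
  have hp := prow_codeFP.comp (hj.pair hR)
  have hb := betaOf_codeFP.comp (hn.pair (hc.pair (hs.pair hp)))
  have hg := (F2Elim.isPiv_codeFP.comp (hj.pair hR)).and hb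
  have hm := CodeFP.map (σ := ℕ × (PCirc × (Vec × List Row))) (eσ := DUE) (eα := natE) (eβ := bitE)
    (g := fun q => isPiv q.1.2.2.2 q.2 && betaOf q.1.1 q.1.2.1 q.1.2.2.1 (prow q.1.2.2.2 q.2)) hg
  exact (hm.comp ((CodeFP.id _).pair (urange.comp (fst _ _)))).congr fun _ => rfl

/-- The code of the offsets context `(n, (c, (S, A)))`. [folklore] -/
abbrev OFE : ℕ × (PCirc × (Mat × Mat)) → List Bool := pairE unE (pairE pcE (pairE matE matE))

/-- Offsets on codes: `(n, (c, (S, A))) ↦ offsOf n c S A`. [cite: AroraBarak2009, §1.3] -/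
theorem offsOf_codeFP : CodeFP OFE matE (fun t => offsOf t.1 t.2.1 t.2.2.1 t.2.2.2) := by
  have hn : CodeFP OFE unE (fun t => t.1) := fst _ _
  have hc : CodeFP OFE pcE (fun t => t.2.1) := (snd _ _).fst'
  have hS : CodeFP OFE matE (fun t => t.2.2.1) := (snd _ _).snd'.fst'
  have hA : CodeFP OFE matE (fun t => t.2.2.2) := (snd _ _).snd'.snd'
  have hR := F2Elim.rrun_codeFP.comp (hn.pair (kerOf_codeFP.comp (hn.pair hA)))
  -- context `(n, (c, R))`, item `s`
  have hg := dualOf_codeFP.comp ((fst (pairE unE (pairE pcE stCE)) bitsE).fst'.pair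
    ((fst (pairE unE (pairE pcE stCE)) bitsE).snd'.fst'.pair ((snd _ _).pair (fst (pairE unE (pairE pcE stCE)) bitsE).snd'.snd')))
  have hm := CodeFP.map (σ := ℕ × (PCirc × List Row)) (eσ := pairE unE (pairE pcE stCE)) (eα := bitsE) (eβ := bitsE)
    (g := fun q => dualOf q.1.1 q.1.2.1 q.2 q.1.2.2) hg
  exact (hm.comp ((hn.pair (hc.pair hR)).pair hS)).congr fun _ => rfl

/-- **Generators of `Λ` on codes**: `(n, (c, S)) ↦ lamOf n c S`. [cite: AroraBarak2009, §1.3] -/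
theorem lamOf_codeFP : CodeFP STE matE (fun t => lamOf t.1 t.2.1 t.2.2) := by
  have hn : CodeFP STE unE (fun t => t.1) := fst _ _
  have hc : CodeFP STE pcE (fun t => t.2.1) := (snd _ _).fst'
  have hS : CodeFP STE matE (fun t => t.2.2) := (snd _ _).snd'
  have hst := stackOf_codeFP
  have hoff := offsOf_codeFP.comp (hn.pair (hc.pair (hS.pair hst)))
  exact ((rawAppend bitsE).comp (hst.pair hoff)).congr fun _ => rfl

/-- The code of the check context `(n, (c, (S, U)))`. [folklore] -/
abbrev CKE : ℕ × (PCirc × (Mat × Mat)) → List Bool := pairE unE (pairE pcE (pairE matE matE))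

/-- **The closedness check on codes**: `(n, (c, (S, U))) ↦ closedChk n c S U`. [cite: AroraBarak2009, §1.3] -/
theorem closedChk_codeFP : CodeFP CKE bitE (fun t => closedChk t.1 t.2.1 t.2.2.1 t.2.2.2) := by
  have hn : CodeFP CKE unE (fun t => t.1) := fst _ _
  have hc : CodeFP CKE pcE (fun t => t.2.1) := (snd _ _).fst'
  have hS : CodeFP CKE matE (fun t => t.2.2.1) := (snd _ _).snd'.fst'
  have hU : CodeFP CKE matE (fun t => t.2.2.2) := (snd _ _).snd'.snd'
  have hlam := lamOf_codeFP.comp (hn.pair (hc.pair hS))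
  -- item `x`, context `(n, U)`
  have hp := inSpan_codeFP.comp ((fst (pairE unE matE) bitsE).fst'.pair ((fst (pairE unE matE) bitsE).snd'.pair (snd _ _)))
  have hall := CodeFP.all (σ := ℕ × Mat) (eσ := pairE unE matE) (eα := bitsE) (p := fun q => inSpan q.1.1 q.1.2 q.2) hp
  exact (hall.comp ((hn.pair hU).pair hlam)).congr fun _ => rfl

/-- **The orthogonality check on codes**: `(n, (S, U)) ↦ orthChk n S U`. [cite: AroraBarak2009, §1.3] -/
theorem orthChk_codeFP : CodeFP (pairE unE (pairE matE matE)) bitE (fun t => orthChk t.1 t.2.1 t.2.2) := by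
  have hp := (dotL_codeFP.comp ((fst unE (pairE bitsE bitsE)).pair (snd _ _))).not
  have hall := CodeFP.all (σ := ℕ) (eσ := unE) (eα := pairE bitsE bitsE) (p := fun q => !dotL q.1 q.2.1 q.2.2) hp
  have hprod := (rawProduct bitsE bitsE).comp ((snd unE (pairE matE matE)).fst'.pair (snd unE (pairE matE matE)).snd')
  exact (hall.comp ((fst _ _).pair hprod)).congr fun _ => rfl

/-! ### Shapes of the generated row lists -/

/-- Every row of a slice has length `n`, and a slice has `n` rows. [folklore] -/
theorem shape_sliceOf (n : ℕ) (c : PCirc) (s : Vec) : (sliceOf n c s).length = n ∧ ∀ r ∈ sliceOf n c s, r.length = n := by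
  refine ⟨by simp [sliceOf], fun r hr => ?_⟩
  obtain ⟨i, -, rfl⟩ := List.mem_map.1 hr
  exact length_rowOf _ _ _ _

/-- Every row of `stackOf` has length `n`. [folklore] -/
theorem length_of_mem_stackOf {n : ℕ} {c : PCirc} {S : Mat} {r : Vec} (hr : r ∈ stackOf n c S) : r.length = n := by
  obtain ⟨B, hB, hrB⟩ := List.mem_flatten.1 hr
  obtain ⟨s, -, rfl⟩ := List.mem_map.1 hB
  exact (shape_sliceOf n c s).2 r hrB

/-- `stackOf` has `|S| · n` rows. [folklore] -/
theorem length_stackOf (n : ℕ) (c : PCirc) (S : Mat) : (stackOf n c S).length = S.length * n := by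
  unfold stackOf
  induction S with
  | nil => simp
  | cons s S ih =>
    rw [List.map_cons, List.flatten_cons, List.length_append, ih, (shape_sliceOf n c s).1, List.length_cons]
    ring

/-- Every row of `offsOf` has length `n`, and there are `|S|` of them. [folklore] -/
theorem shape_offsOf (n : ℕ) (c : PCirc) (S A : Mat) : (offsOf n c S A).length = S.length ∧ ∀ r ∈ offsOf n c S A, r.length = n := by
  refine ⟨by simp [offsOf], fun r hr => ?_⟩
  obtain ⟨s, -, rfl⟩ := List.mem_map.1 hr
  exact length_dualOf _ _ _ _

/-- Every generator of `Λ` has length `n`, and there are `|S| · (n + 1)` of them. [folklore] -/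
theorem shape_lamOf (n : ℕ) (c : PCirc) (S : Mat) : (lamOf n c S).length = S.length * (n + 1) ∧ ∀ r ∈ lamOf n c S, r.length = n := by
  refine ⟨?_, fun r hr => ?_⟩
  · rw [lamOf, List.length_append, length_stackOf, (shape_offsOf n c S _).1]; ring
  · rcases List.mem_append.1 hr with h | h
    · exact length_of_mem_stackOf h
    · exact (shape_offsOf n c S _).2 r h

end Summit.QuantumAdvantage.QuantumAdvantage.Theorems.SignedExactCubicForrelationNotPrBPP.GrowMachine

end
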